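import Summits.ResolutionOfSingularities.ResolutionOfSingularities.Theorems.FrobeniusLadderFRationalResolutionTraceIdealsFiniteMonoidPowerSeries
import Literature.AlgebraicGeometry.Resolution.LogRegularCompleteStructure
import HarnessLib

/-!
# Crux `FrobeniusLadder.FRationalResolution` (stmt-ResolutionOfSingularities-15317), line `redirect`,
# stub `stub_diagonalizableQuotientResolution` — `hfin` FROM KATO CHART DATA (Thm. (3.2) (1), d = 0)

`…TraceIdealsFiniteMonoidPowerSeries.hfin_of_ringEquiv_monoidPowerSeries` (p840387) reduced the `hfin` slot of the (S1) recipe to a ring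
isomorphism `Ê ≅ κ⟦P⟧`, `P` the weight kernel. Kato's structure theorem as PROVED in the tree (`LogRegularCompleteStructure.exists_lift_surjective`
+ `ker_eq_bot_of_field`) produces exactly such an isomorphism from d = 0 CHART DATA on a complete Noetherian local ring `E` containing a
coefficient field: a multiplicative `φ : P → E` with `φ(P ∖ 0)` generating `𝔪_E` and `dim E = rank P`.

★★★ `hfin_of_chartData` — complete Noetherian local `E`, coefficient field `j : κ → E` (residue-surjective), chart `φ` by the weight kernel
`P ⊆ ℕⁿ` of `w : Fin n → ℤ/r` with `dim E = rank P` ⇒ the set of trace ideals of the nonzero divisorial ideals of `E` is finite.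

So for the twisted isolated quotient points, `hfin` is now reduced to the LOG-REGULAR CHART at the point (`φ`, `hgen`, `hdim`: the diagonalizable
quotient structure; cf. `…EveryPointLogRegular`, `…FixedPointKatoIdeal`) and a coefficient field of `Ê` (Cohen). Honest label: assembly toward ONE
leaf stub (no stub, crux or summit closed). No definitions, no named facts, no sorry. [cite: Kato1994, Thm. (3.2)] [cite: Matsumura1987, Thm. 8.4; Thm. 28.3]
-/

noncomputable section

-- single-problem summit: the doubled namespace component is forced
set_option linter.dupNamespace false

open IsLocalRing Literature.RingTheory.MvPowerSeries Literature.RingTheory.MvPowerSeries.monoidPowerSeries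
open Literature.AlgebraicGeometry.Resolution
open Summit.ResolutionOfSingularities.ResolutionOfSingularities.Theorems.FRationalResolution

namespace Summit.ResolutionOfSingularities.ResolutionOfSingularities.Theorems.FRationalResolution.HfinOfChartData

/-- ★ **Kato (3.2) (1) as an isomorphism**: d = 0 chart data by `P` on a complete Noetherian local ring with a coefficient field give
`κ⟦P⟧ ≃+* E` extending the chart. [cite: Kato1994, Thm. (3.2)] [cite: Matsumura1987, Thm. 8.4] -/
theorem exists_ringEquiv_monoidPowerSeries_of_chartData {E : Type} [CommRing E] [IsLocalRing E] [IsNoetherianRing E]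
    [IsAdicComplete (maximalIdeal E) E] (κ : Type) [Field κ] (j : κ →+* E) [IsLocalHom j]
    (hres : ∀ a : E, ∃ l : κ, a - j l ∈ maximalIdeal E) {n : ℕ} (P : AddSubmonoid (Fin n →₀ ℕ)) (hPfg : P.FG)
    (φ : (Fin n →₀ ℕ) → E) (hφ0 : φ 0 = 1) (hφadd : ∀ a ∈ P, ∀ b ∈ P, φ (a + b) = φ a * φ b)
    (hφm : ∀ p ∈ P, p ≠ 0 → φ p ∈ maximalIdeal E) (hgen : maximalIdeal E ≤ Ideal.span (φ '' {p | p ∈ P ∧ p ≠ 0}))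
    (hdim : ringKrullDim E = rank P) :
    ∃ e : ↥(monoidPowerSeries κ P) ≃+* E,
      ∀ (p : Fin n →₀ ℕ) (hp : p ∈ P), e ⟨MvPowerSeries.monomial p (1 : κ), monomial_mem hp 1⟩ = φ p := by
  haveI : IsAdicComplete (maximalIdeal κ) κ := by
    rw [IsLocalRing.maximalIdeal_eq_bot]
    infer_instance
  obtain ⟨ψ, hψsurj, hψφ, -⟩ :=
    LogRegularCompleteStructure.exists_lift_surjective (A := E) (Λ := κ) j hres hPfg φ hφ0 hφadd hφm hgen
  have hker := LogRegularCompleteStructure.ker_eq_bot_of_field (A := E) hPfg ψ hψsurj hdim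
  have hinj : Function.Injective ψ := (RingHom.injective_iff_ker_eq_bot ψ).mpr hker
  exact ⟨RingEquiv.ofBijective ψ ⟨hinj, hψsurj⟩, fun p hp => hψφ p hp⟩

/-- ★★★ **`hfin` from chart data.** `E` complete Noetherian local with a coefficient field `κ`, d = 0 chart data by the WEIGHT KERNEL
`P = {m : Σ m(i) w(i) = 0}` of `w : Fin n → ℤ/r` (`r ≠ 0`) with `dim E = rank P`: the set of trace ideals of the nonzero divisorial ideals of
`E` is finite. [cite: Kato1994, Thm. (3.2)] [folklore; cite: BrunsHerzog1993, §1.5] -/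
theorem hfin_of_chartData {E : Type} [CommRing E] [IsLocalRing E] [IsNoetherianRing E] [IsAdicComplete (maximalIdeal E) E]
    (κ : Type) [Field κ] (j : κ →+* E) [IsLocalHom j] (hres : ∀ a : E, ∃ l : κ, a - j l ∈ maximalIdeal E)
    (n r : ℕ) [NeZero r] (w : Fin n → ZMod r) (P : AddSubmonoid (Fin n →₀ ℕ))
    (hP : ∀ m : Fin n →₀ ℕ, m ∈ P ↔ Finsupp.weight w m = 0) (hPfg : P.FG)
    (φ : (Fin n →₀ ℕ) → E) (hφ0 : φ 0 = 1) (hφadd : ∀ a ∈ P, ∀ b ∈ P, φ (a + b) = φ a * φ b)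
    (hφm : ∀ p ∈ P, p ≠ 0 → φ p ∈ maximalIdeal E) (hgen : maximalIdeal E ≤ Ideal.span (φ '' {p | p ∈ P ∧ p ≠ 0}))
    (hdim : ringKrullDim E = rank P) :
    Set.Finite {T : Ideal E | ∃ I : Ideal E,
      (I ≠ ⊥ ∧ ∀ x : E, (∀ a b : E, (∀ y ∈ I, b * y ∈ Ideal.span ({a} : Set E)) → b * x ∈ Ideal.span ({a} : Set E)) → x ∈ I) ∧
      T = ⨆ ψ : I →ₗ[E] E, LinearMap.range ψ} := by
  obtain ⟨e, -⟩ := exists_ringEquiv_monoidPowerSeries_of_chartData κ j hres P hPfg φ hφ0 hφadd hφm hgen hdim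
  exact TraceIdealsFiniteMonoidPowerSeries.hfin_of_ringEquiv_monoidPowerSeries κ n r w P hP hPfg e

end Summit.ResolutionOfSingularities.ResolutionOfSingularities.Theorems.FRationalResolution.HfinOfChartData

end
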